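import Mathlib
import Summits.MatrixMultiplication.MatrixMultiplication.Theses.NilpotentLieHosts
import Summits.MatrixMultiplication.MatrixMultiplication.Theorems.NilpotentLieHostsUnitriangularCostShapeStubProductModel
import Summits.MatrixMultiplication.MatrixMultiplication.Theorems.NilpotentLieHostsUnitriangularCostShapeStubModelHosts
import Summits.MatrixMultiplication.MatrixMultiplication.Theorems.NilpotentLieHostsUnitriangularCostShapeStubTruncatedMatrixCost

/-!
# Crux-strategist sketch for `NilpotentThresholdDesigns` (stmt-MatrixMultiplication-7720)

Typed forms used by `STRATEGY-CENSUS.md` (unit `cstrat-stmt-MatrixMultiplication-7720-s2`):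

* `UnitriangularCostShapeExplicit` — the PROVED cost crux with its Casimir count made explicit,
  `b = ⌊d/2⌋` (re-composition of the three landed stubs of `UnitriangularCostShape`, via
  `productModel_explicit`): **proved below** (`unitriangularCostShapeExplicit_proof`).
* `TowerDesigns` — the AMORTISED design statement (deficit `ε·⌊d/2⌋` at dimension `d`, for every
  `ε > 0` at SOME `d`), the exact analogue of BlasiakCohnGrochowPrattUmans2024 Thm B (`q^(n²/2 − o(n))`);
  it is a CONSEQUENCE of the crux (`towerDesigns_of_nilpotentThresholdDesigns`) and still decides the
  summit with the explicit cost (`closes_tower`, proved) — the route-level finding of the census.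
* `ExactSaturationDesigns` (census § Strengthen S3), `ScaleSeparatedTPP` (census § Decomposition D3),
  `HostingSubrankBound` (census § Negation N1): typed only.
-/

set_option linter.dupNamespace false
set_option linter.unusedVariables false

noncomputable section

namespace Summit.MatrixMultiplication.MatrixMultiplication.Cruxes.NilpotentThresholdDesigns.Strategist

open Summit.MatrixMultiplication.MatrixMultiplication.Theses.NilpotentLieHosts
open Summit.MatrixMultiplication.MatrixMultiplication.Theorems
open scoped BigOperators Matrix

/-- Cost crux with the explicit Casimir count `b = ⌊d/2⌋` (the landed proof of `UnitriangularCostShape`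
hides it behind `∃ b > 0`). -/
def UnitriangularCostShapeExplicit : Prop :=
  ∀ d : ℕ, 3 ≤ d → ∃ C : ℝ, ∀ (s : ℕ) (X Y Z : Finset (Matrix.SpecialLinearGroup (Fin d) ℤ)), (∀ g ∈ X ∪ Y ∪ Z, ∀ i j : Fin d, j ≤ i → (g : Matrix (Fin d) (Fin d) ℤ) i j = if i = j then 1 else 0) → (∀ x ∈ X, ∀ x' ∈ X, ∀ y ∈ Y, ∀ y' ∈ Y, ∀ z ∈ Z, ∀ z' ∈ Z, x * y⁻¹ * y' * z⁻¹ = x' * z'⁻¹ → x = x' ∧ y = y' ∧ z = z') → (∀ x₀ ∈ X, ∀ z₀ ∈ Z, ∃ p : MvPolynomial (Fin d × Fin d) ℂ, MvPolynomial.weightedTotalDegree (fun ij : Fin d × Fin d => (ij.2 : ℕ) - ij.1) p ≤ s ∧ ∀ x ∈ X, ∀ y ∈ Y, ∀ y' ∈ Y, ∀ z ∈ Z, MvPolynomial.eval (fun ij : Fin d × Fin d => (((x * y⁻¹ * y' * z⁻¹ : Matrix.SpecialLinearGroup (Fin d) ℤ) : Matrix (Fin d) (Fin d) ℤ) ij.1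 ij.2 : ℂ)) p = if x = x₀ ∧ y = y' ∧ z = z₀ then 1 else 0) → ((X.card : ℝ) * Y.card * Z.card) ^ (Literature.Computability.AlgebraicComplexity.omega ℂ / 3) ≤ C * ((s : ℝ) + 1) ^ (((d : ℝ) * (d - 1) / 2 - ((d / 2 : ℕ) : ℝ)) / 2 * Literature.Computability.AlgebraicComplexity.omega ℂ + ((d / 2 : ℕ) : ℝ))

/-- AMORTISED TOWER DESIGNS: for every `ε > 0` some `U_d(ℤ)`, `d ≥ 3`, carries, for unboundedly many
budgets `s`, TPP designs with weighted-degree-`≤ s` separating polynomials and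
`|X||Y||Z| ≥ s^((3/4)d(d−1) − ε·⌊d/2⌋)` — deficit `ε·⌊d/2⌋` instead of the crux's `δ → 0` at fixed `d`. -/
def TowerDesigns : Prop :=
  ∀ ε : ℝ, 0 < ε → ∃ d : ℕ, 3 ≤ d ∧ ∀ s₀ : ℕ, ∃ s : ℕ, s₀ ≤ s ∧ ∃ X Y Z : Finset (Matrix.SpecialLinearGroup (Fin d) ℤ), (∀ g ∈ X ∪ Y ∪ Z, ∀ i j : Fin d, j ≤ i → (g : Matrix (Fin d) (Fin d) ℤ) i j = if i = j then 1 else 0) ∧ (∀ x ∈ X, ∀ x' ∈ X, ∀ y ∈ Y, ∀ y' ∈ Y, ∀ z ∈ Z, ∀ z' ∈ Z, x * y⁻¹ * y' * z⁻¹ = x' * z'⁻¹ → x = x' ∧ y = y' ∧ z = z') ∧ (∀ x₀ ∈ X, ∀ z₀ ∈ Z, ∃ p : MvPolynomial (Fin d × Fin d) ℂ, MvPolynomial.weightedTotalDegree (fun ij : Fin d × Fin d => (ij.2 : ℕ) - ij.1) p ≤ s ∧ ∀ x ∈ X, ∀ y ∈ Y, ∀ y' ∈ Y, ∀ z ∈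 Z, MvPolynomial.eval (fun ij : Fin d × Fin d => (((x * y⁻¹ * y' * z⁻¹ : Matrix.SpecialLinearGroup (Fin d) ℤ) : Matrix (Fin d) (Fin d) ℤ) ij.1 ij.2 : ℂ)) p = if x = x₀ ∧ y = y' ∧ z = z₀ then 1 else 0) ∧ (s : ℝ) ^ ((3 : ℝ) / 4 * d * (d - 1) - ε * ((d / 2 : ℕ) : ℝ)) ≤ (X.card : ℝ) * Y.card * Z.card

/-- **The explicit cost shape is provable now**: the composition of the three LANDED stubs of
`UnitriangularCostShape` (product model with `k = ⌊d/2⌋` Casimirs, hosting, truncated matrix cost). -/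
theorem unitriangularCostShapeExplicit_proof : UnitriangularCostShapeExplicit := by
  intro d hd
  obtain ⟨c, hc, hmodel⟩ := UnitriangularCostShape.productModel_explicit d hd
  obtain ⟨κ, hκ, hcostk⟩ := UnitriangularCostShape.stub_truncatedMatrixCost (d / 2)
  refine ⟨κ * c ^ Literature.Computability.AlgebraicComplexity.omega ℂ * c, ?_⟩
  intro s X Y Z hU _hT hS
  obtain ⟨t, N, hN, ht, ρ, hρ⟩ := hmodel s
  obtain ⟨α, β, γ, hhost⟩ := UnitriangularCostShape.stub_modelHosts d (d / 2) t N s ρ X Y Z hρ hU hS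
  have hcost := hcostk t N X.card Y.card Z.card α β γ hhost
  set w : ℝ := Literature.Computability.AlgebraicComplexity.omega ℂ with hw
  set b : ℝ := ((d / 2 : ℕ) : ℝ) with hb
  set A : ℝ := ((d : ℝ) * (d - 1) / 2 - b) / 2 with hA
  have hw0 : 0 ≤ w :=
    zero_le_two.trans (Literature.Computability.AlgebraicComplexity.omega_two_le ℂ)
  have hs0 : (0 : ℝ) < (s : ℝ) + 1 := by positivity
  have hsA : (0 : ℝ) ≤ ((s : ℝ) + 1) ^ A := Real.rpow_nonneg hs0.le A
  have hcw : (0 : ℝ) ≤ c ^ w := Real.rpow_nonneg hc.le w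
  have h1 : (N : ℝ) ^ w ≤ c ^ w * ((s : ℝ) + 1) ^ (A * w) :=
    calc (N : ℝ) ^ w ≤ (c * ((s : ℝ) + 1) ^ A) ^ w := Real.rpow_le_rpow (Nat.cast_nonneg N) hN hw0
      _ = c ^ w * (((s : ℝ) + 1) ^ A) ^ w := Real.mul_rpow hc.le hsA
      _ = c ^ w * ((s : ℝ) + 1) ^ (A * w) := by rw [Real.rpow_mul hs0.le]
  have h2 : (N : ℝ) ^ w * (t : ℝ) ^ (d / 2) ≤
      (c ^ w * ((s : ℝ) + 1) ^ (A * w)) * (c * ((s : ℝ) + 1) ^ b) :=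
    mul_le_mul h1 ht (by positivity) (mul_nonneg hcw (Real.rpow_nonneg hs0.le _))
  have h3 : κ * ((c ^ w * ((s : ℝ) + 1) ^ (A * w)) * (c * ((s : ℝ) + 1) ^ b)) =
      κ * c ^ w * c * ((s : ℝ) + 1) ^ (A * w + b) := by
    rw [Real.rpow_add hs0]
    ring
  have hcard : ((X.card * Y.card * Z.card : ℕ) : ℝ) = (X.card : ℝ) * Y.card * Z.card := by
    simp only [Nat.cast_mul]
  calc ((X.card : ℝ) * Y.card * Z.card) ^ (w / 3)
      = ((X.card * Y.card * Z.card : ℕ) : ℝ) ^ (w / 3) := by rw [hcard]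
    _ ≤ κ * (N : ℝ) ^ w * (t : ℝ) ^ (d / 2) := hcost
    _ = κ * ((N : ℝ) ^ w * (t : ℝ) ^ (d / 2)) := by ring
    _ ≤ κ * ((c ^ w * ((s : ℝ) + 1) ^ (A * w)) * (c * ((s : ℝ) + 1) ^ b)) :=
      mul_le_mul_of_nonneg_left h2 hκ.le
    _ = κ * c ^ w * c * ((s : ℝ) + 1) ^ (A * w + b) := h3

/-- The amortised tower statement is a CONSEQUENCE of the crux (take the crux's `d` and `δ := ε·⌊d/2⌋`). -/
theorem towerDesigns_of_nilpotentThresholdDesigns : NilpotentThresholdDesigns → TowerDesigns := by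
  rintro ⟨d, hd3, hD⟩ ε hε
  refine ⟨d, hd3, fun s₀ => ?_⟩
  have hb : (0 : ℝ) < ((d / 2 : ℕ) : ℝ) := by exact_mod_cast (show 0 < d / 2 by omega)
  obtain ⟨s, hs, X, Y, Z, hU, hT, hS, hV⟩ := hD (ε * ((d / 2 : ℕ) : ℝ)) (mul_pos hε hb) s₀
  exact ⟨s, hs, X, Y, Z, hU, hT, hS, hV⟩

/-- **The amortised route still decides the summit.**  `UnitriangularCostShapeExplicit → TowerDesigns →
ω(ℂ) = 2`: if `2 < ω`, feed the tower the loss `ε := 3(ω−2)/(4ω)`; at the returned `d` (with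
`b = ⌊d/2⌋ ≥ 1`) the design exponent times `ω/3` exceeds the cost exponent
`F = ((D − b)/2)ω + b` by `g = b(ω−2)/4 > 0`, contradicting unbounded budgets. -/
theorem closes_tower (hCost : UnitriangularCostShapeExplicit) (hTower : TowerDesigns) :
    MatrixMultiplication := by
  show Literature.Computability.AlgebraicComplexity.omega ℂ = 2
  have hw2 : 2 ≤ Literature.Computability.AlgebraicComplexity.omega ℂ :=
    Literature.Computability.AlgebraicComplexity.omega_two_le ℂ
  refine le_antisymm ?_ hw2
  refine not_lt.1 fun hlt => ?_
  set w : ℝ := Literature.Computability.AlgebraicComplexity.omega ℂ with hwdef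
  have hwpos : 0 < w := lt_of_lt_of_le two_pos hw2
  have hw2' : 0 < w - 2 := sub_pos.2 hlt
  have hwne : w ≠ 0 := hwpos.ne'
  -- the loss fed to the tower
  set ε : ℝ := 3 * (w - 2) / (4 * w) with hεdef
  have hε : 0 < ε := div_pos (mul_pos three_pos hw2') (mul_pos four_pos hwpos)
  obtain ⟨d, hd3, hD⟩ := hTower ε hε
  obtain ⟨C, hC⟩ := hCost d hd3
  set b : ℝ := ((d / 2 : ℕ) : ℝ) with hbdef
  have hb : 0 < b := by
    rw [hbdef]; exact_mod_cast (show 0 < d / 2 by omega)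
  set F : ℝ := ((d : ℝ) * (d - 1) / 2 - b) / 2 * w + b with hFdef
  set g : ℝ := b * (w - 2) / 4 with hgdef
  have hg : 0 < g := div_pos (mul_pos hb hw2') four_pos
  have hεw : ε * b * (w / 3) = b * (w - 2) / 4 := by
    rw [hεdef]; field_simp
  have hexp : ((3 : ℝ) / 4 * d * (d - 1) - ε * b) * (w / 3) = g + F := by
    have : ((3 : ℝ) / 4 * d * (d - 1) - ε * b) * (w / 3) =
        (3 : ℝ) / 4 * d * (d - 1) * (w / 3) - ε * b * (w / 3) := by ring
    rw [this, hεw, hgdef, hFdef]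
    ring
  -- constants
  set C' : ℝ := max C 1 with hC'def
  set K : ℝ := max 1 ((2 : ℝ) ^ F) with hKdef
  have hC'1 : 1 ≤ C' := le_max_right _ _
  have hK1 : 1 ≤ K := le_max_left _ _
  have hC'0 : 0 ≤ C' := zero_le_one.trans hC'1
  obtain ⟨M, hM⟩ := Filter.tendsto_atTop_atTop.1 (tendsto_rpow_atTop hg) (C' * K + 1)
  obtain ⟨s, hs, X, Y, Z, hU, hT, hS, hV⟩ := hD (max 1 (Nat.ceil M))
  have hs1 : 1 ≤ s := (le_max_left _ _).trans hs
  have hsM : M ≤ (s : ℝ) :=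
    (Nat.le_ceil M).trans (by exact_mod_cast (le_max_right 1 (Nat.ceil M)).trans hs)
  have hsR1 : (1 : ℝ) ≤ s := by exact_mod_cast hs1
  have hsR0 : (0 : ℝ) < s := one_pos.trans_le hsR1
  have hcost := hC s X Y Z hU hT hS
  have hV0 : (0 : ℝ) ≤ (X.card : ℝ) * Y.card * Z.card := by positivity
  have hsF : (0 : ℝ) < (s : ℝ) ^ F := Real.rpow_pos_of_pos hsR0 F
  have h1 : (s : ℝ) ^ g * (s : ℝ) ^ F ≤ ((X.card : ℝ) * Y.card * Z.card) ^ (w / 3) := by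
    rw [← Real.rpow_add hsR0, ← hexp, Real.rpow_mul hsR0.le]
    exact Real.rpow_le_rpow (Real.rpow_nonneg hsR0.le _) hV (div_nonneg hwpos.le three_pos.le)
  have h2 : C * ((s : ℝ) + 1) ^ F ≤ C' * (K * (s : ℝ) ^ F) := by
    have hs1F : (0 : ℝ) ≤ ((s : ℝ) + 1) ^ F := Real.rpow_nonneg (by positivity) F
    have h3 : ((s : ℝ) + 1) ^ F ≤ K * (s : ℝ) ^ F := by
      rcases le_or_gt 0 F with hF | hF
      · calc ((s : ℝ) + 1) ^ F ≤ (2 * (s : ℝ)) ^ F :=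
              Real.rpow_le_rpow (by positivity) (by linarith) hF
          _ = (2 : ℝ) ^ F * (s : ℝ) ^ F := Real.mul_rpow zero_le_two hsR0.le
          _ ≤ K * (s : ℝ) ^ F := mul_le_mul_of_nonneg_right (le_max_right _ _) hsF.le
      · calc ((s : ℝ) + 1) ^ F ≤ (s : ℝ) ^ F :=
              Real.rpow_le_rpow_of_nonpos hsR0 (by linarith) hF.le
          _ = 1 * (s : ℝ) ^ F := (one_mul _).symm
          _ ≤ K * (s : ℝ) ^ F := mul_le_mul_of_nonneg_right hK1 hsF.le
    calc C * ((s : ℝ) + 1) ^ F ≤ C' * ((s : ℝ) + 1) ^ F :=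
          mul_le_mul_of_nonneg_right (le_max_left _ _) hs1F
      _ ≤ C' * (K * (s : ℝ) ^ F) := mul_le_mul_of_nonneg_left h3 hC'0
  have h4 : (s : ℝ) ^ g * (s : ℝ) ^ F ≤ C' * K * (s : ℝ) ^ F := by
    rw [mul_assoc]
    exact h1.trans (hcost.trans h2)
  have h5 : (s : ℝ) ^ g ≤ C' * K := le_of_mul_le_mul_right h4 hsF
  have h6 : C' * K + 1 ≤ (s : ℝ) ^ g := hM (s : ℝ) hsM
  linarith

/-- Hence, unconditionally in the tree today: `TowerDesigns → ω(ℂ) = 2`. -/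
theorem matrixMultiplication_of_towerDesigns (h : TowerDesigns) : MatrixMultiplication :=
  closes_tower unitriangularCostShapeExplicit_proof h

/-! ## Census signatures (typed only) -/

/-- § Strengthen (S3): EXACT SATURATION — all three packing inequalities are equalities
(`|X||Z| = |X||Y| = |Y||Z| = dim Pol^wt_≤s`, written without naming the dimension: the three pairwise
products coincide and their cube is the square of the triple product … we only record the rigid form
"pairwise products equal and the crux's size bound with δ = 0 up to a constant"). -/
def ExactSaturationDesigns : Prop :=
  ∃ d : ℕ, 3 ≤ d ∧ ∃ c : ℝ, 0 < c ∧ ∀ s₀ : ℕ, ∃ s : ℕ, s₀ ≤ s ∧ ∃ X Y Z : Finset (Matrix.SpecialLinearGroup (Fin d) ℤ), (∀ g ∈ X ∪ Y ∪ Z, ∀ i j : Fin d, j ≤ i → (g : Matrix (Fin d) (Fin d) ℤ) i j = if i = j then 1 else 0) ∧ (∀ x ∈ X, ∀ x' ∈ X, ∀ y ∈ Y, ∀ y' ∈ Y, ∀ z ∈ Z, ∀ z' ∈ Z, x * y⁻¹ * y' * z⁻¹ = x' * z'⁻¹ → x = x' ∧ y = y' ∧ z = z') ∧ (∀ x₀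 ∈ X, ∀ z₀ ∈ Z, ∃ p : MvPolynomial (Fin d × Fin d) ℂ, MvPolynomial.weightedTotalDegree (fun ij : Fin d × Fin d => (ij.2 : ℕ) - ij.1) p ≤ s ∧ ∀ x ∈ X, ∀ y ∈ Y, ∀ y' ∈ Y, ∀ z ∈ Z, MvPolynomial.eval (fun ij : Fin d × Fin d => (((x * y⁻¹ * y' * z⁻¹ : Matrix.SpecialLinearGroup (Fin d) ℤ) : Matrix (Fin d) (Fin d) ℤ) ij.1 ij.2 : ℂ)) p = if x = x₀ ∧ y = y' ∧ z = z₀ then 1 else 0) ∧ X.card = Y.card ∧ Y.card = Z.card ∧ c * (s : ℝ) ^ ((3 : ℝ) / 4 * d * (d - 1)) ≤ (X.card : ℝ) * Y.card * Z.card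

/-- `ExactSaturationDesigns → NilpotentThresholdDesigns` (the rigid form feeds the crux: `c·s^E ≥ s^(E−δ)`
for `s ≥ c^(−1/δ)`). -/
theorem nilpotentThresholdDesigns_of_exactSaturation (h : ExactSaturationDesigns) :
    NilpotentThresholdDesigns := by
  obtain ⟨d, hd3, c, hc, hD⟩ := h
  refine ⟨d, hd3, fun δ hδ s₀ => ?_⟩
  -- budgets beyond `c^(-1/δ)` absorb the constant
  obtain ⟨M, hM⟩ := Filter.tendsto_atTop_atTop.1 (tendsto_rpow_atTop hδ) (c⁻¹ + 1)
  obtain ⟨s, hs, X, Y, Z, hU, hT, hS, -, -, hV⟩ := hD (max (max s₀ 1) (Nat.ceil M))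
  refine ⟨s, le_trans (le_max_left _ _ |>.trans' (le_max_left _ _)) hs |>.trans' le_rfl, X, Y, Z, hU, hT, hS, ?_⟩
  have hs1 : (1 : ℝ) ≤ s := by exact_mod_cast ((le_max_right _ _).trans ((le_max_left _ _).trans hs))
  have hs0 : (0 : ℝ) < s := one_pos.trans_le hs1
  have hsM : M ≤ (s : ℝ) := (Nat.le_ceil M).trans (by exact_mod_cast (le_max_right _ _).trans hs)
  have hδs : c⁻¹ + 1 ≤ (s : ℝ) ^ δ := hM _ hsM
  have hcs : 1 ≤ c * (s : ℝ) ^ δ := by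
    have : c⁻¹ ≤ (s : ℝ) ^ δ := by linarith
    calc (1 : ℝ) = c * c⁻¹ := by field_simp
      _ ≤ c * (s : ℝ) ^ δ := mul_le_mul_of_nonneg_left this hc.le
  calc (s : ℝ) ^ ((3 : ℝ) / 4 * d * (d - 1) - δ)
      = (s : ℝ) ^ ((3 : ℝ) / 4 * d * (d - 1)) / (s : ℝ) ^ δ := Real.rpow_sub hs0 _ _
    _ ≤ c * (s : ℝ) ^ ((3 : ℝ) / 4 * d * (d - 1)) := by
        rw [div_le_iff₀ (Real.rpow_pos_of_pos hs0 δ)]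
        calc (s : ℝ) ^ ((3 : ℝ) / 4 * d * (d - 1)) = (s : ℝ) ^ ((3 : ℝ) / 4 * d * (d - 1)) * 1 := (mul_one _).symm
          _ ≤ (s : ℝ) ^ ((3 : ℝ) / 4 * d * (d - 1)) * (c * (s : ℝ) ^ δ) :=
              mul_le_mul_of_nonneg_left hcs (Real.rpow_nonneg hs0.le _)
          _ = c * (s : ℝ) ^ ((3 : ℝ) / 4 * d * (d - 1)) * (s : ℝ) ^ δ := by ring
    _ ≤ (X.card : ℝ) * Y.card * Z.card := hV

/-- § Decomposition (D3), the glue that IS provable: SCALE SEPARATION gives the TPP for free.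
If `X, Z` have the double-product property (`(x, z) ↦ x z⁻¹` injective) and `Y` is obtained from any
finite `Y₀` by the graded dilation `δ_λ : g_ij ↦ λ^(j−i) g_ij` (an injective endomorphism of `U_d(ℤ)`) with
`λ` large against the entries of `X, Z, Y₀`, then `X, δ_λ(Y₀), Z` satisfy the TPP (coefficient comparison
of `x'⁻¹ x · δ_λ(y⁻¹y') · z⁻¹ z'` as a polynomial in `λ`).  Stated with the dilation as a bare function
hypothesis `dil`. -/
def ScaleSeparatedTPP : Prop :=
  ∀ (d : ℕ) (X Z Y₀ : Finset (Matrix.SpecialLinearGroup (Fin d) ℤ)),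
    (∀ g ∈ X ∪ Y₀ ∪ Z, ∀ i j : Fin d, j ≤ i → (g : Matrix (Fin d) (Fin d) ℤ) i j = if i = j then 1 else 0) →
    (∀ x ∈ X, ∀ x' ∈ X, ∀ z ∈ Z, ∀ z' ∈ Z, x * z⁻¹ = x' * z'⁻¹ → x = x' ∧ z = z') →
    ∃ Λ : ℕ, ∀ lam : ℤ, (Λ : ℤ) ≤ lam →
      ∀ dil : Matrix.SpecialLinearGroup (Fin d) ℤ → Matrix.SpecialLinearGroup (Fin d) ℤ,
        (∀ g : Matrix.SpecialLinearGroup (Fin d) ℤ, ∀ i j : Fin d,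
            (dil g : Matrix (Fin d) (Fin d) ℤ) i j =
              if i = j then 1 else lam ^ ((j : ℕ) - i) * (g : Matrix (Fin d) (Fin d) ℤ) i j) →
        ∀ x ∈ X, ∀ x' ∈ X, ∀ y ∈ Y₀, ∀ y' ∈ Y₀, ∀ z ∈ Z, ∀ z' ∈ Z,
          x * (dil y)⁻¹ * dil y' * z⁻¹ = x' * z'⁻¹ → x = x' ∧ y = y' ∧ z = z'

/-- § Negation (N1), the typed handle: SUBRANK CEILING of hosting.  If `⟨n, m, p⟩` is hosted in an algebra
`A` with finite basis `b` (the situation of the route's landed `HostingBound`), then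
`min(nm, mp, pn) ≤ Q̃(T_A)` (asymptotic subrank of the structure tensor): `⟨n,m,p⟩` restricts to `T_A`
and `Q̃⟨n,m,p⟩ = min(nm,mp,pn)` (tight support with uniform marginals; Strassen 1991). -/
def HostingSubrankBound : Prop :=
  ∀ (A : Type) [Ring A] [Algebra ℂ A] (ι : Type) [Fintype ι] (b : Module.Basis ι ℂ A) (n m p : ℕ)
    (α : Matrix (Fin n) (Fin m) ℂ →ₗ[ℂ] A) (β : Matrix (Fin m) (Fin p) ℂ →ₗ[ℂ] A)
    (γ : A →ₗ[ℂ] Matrix (Fin n) (Fin p) ℂ), (∀ M N, γ (α M * β N) = M * N) →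
    ((min (n * m) (min (m * p) (p * n)) : ℕ) : ℝ) ≤
      Literature.Computability.AlgebraicComplexity.asymptoticSubrank ℂ
        (Literature.Computability.AlgebraicComplexity.structureTensor b)

end Summit.MatrixMultiplication.MatrixMultiplication.Cruxes.NilpotentThresholdDesigns.Strategist

end
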